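import Summits.QuantumFields.YangMills.Theorems.BalabanUVNodesN15TwoGridL2Blocks
import Summits.QuantumFields.YangMills.Theorems.BalabanUVNodesN15TwoGridEntry0
import HarnessLib

/-!
# Route «BalabanUVNodes», node N15 = NE2, -a lane, part 63: THE WEIGHTED-ADJOINT CALCULUS OF THE TWO-GRID OPERATORS — the pairing `wdot`, its algebra, and the adjoint pairs
# `G ↔ G`, `Δ_a ↔ Δ_a`, `∂Π∂* ↔ ∂Π∂*`, `ρ(σ) ↔ ρ(σ̄)` (shifts ↔ inverse shifts, `∇ ↔ ∇*`), `a·Q*Q ↔ a·Q*Q`, King's `P ↔ R` (block average) — entry 2 of [B9] (3.42), third file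

Cell `pub-ymgap`, seat `pub-ymgap-dag-n15-a` (KNIT-BY-NAME, g13); `--supports stmt-QuantumFields-20507 --as helper` (two plumbing data `def`s, `wdot` and `ravg`; no Prop-valued definition).
Over part 61 (`hasMaj_of_adjoint`, which CONSUMES an adjoint identity `w₂·Σ f·Tμ = w₁·Σ (Sf)·μ`), part 46 (`deltaOp`, `landauRe`, `deltaOp_eq`), part 39 (`gOp`), part 34 (`symbOp`), part 37
(`qvRe`, `qvAdjRe`), b05's `B5RealFields.GR_transpose` ∕ `DeltaAR_transpose` ∕ `reM_transpose_of_isHermitian` and `B5Value126.PcT_conjTranspose`.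
WHAT.  §85 `LinearMap.IsAdjointPair (wdot w₁) (wdot w₂) T S` (the weighted adjoint relation) and its algebra (`symm`, `comp`, `add`, `sub`, `neg`, `smul`, `zero`, `id`, uniqueness `IsAdj.unique`).  §86 the SAME-LATTICE
pairs: `isAdj_mulVecLin` (`A ↔ Aᵀ`), ★ `isAdj_gOp` (`G ↔ G`: Bałaban's *"The operator G is a symmetric operator"*, Prop. 1.1 p.33), `isAdj_deltaOp`, ★ `isAdj_landauRe` (`∂Π∂*` is symmetric:
`PcTᴴ = PcT`), `isAdj_symbOp_single` (a translation ↔ the inverse translation), `isAdj_symbOp_mul` (closure under products of symbols), `isAdj_sT_pow` ∕ `isAdj_sTinv_pow`, ★ `isAdj_sD` (`∇_ν ↔ ∇_ν*`: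
`ρ(c(s_ν−1)) ↔ ρ(c(s_ν⁻¹−1))`) and `isAdj_sDbar`, ★ `isAdj_qq` (`a·Q*Q = Δ_a − ρ(sLap) + ∂Π∂*` is symmetric, `sLap ↔ sLap`).  §87 the TWO-LATTICE pair: `ravg` (King's block AVERAGE `R`,
fine 1-forms → coarse 1-forms, `(Rf)(x, κ) = L^{−m(d+1)}Σ_{x′ ∈ B_m(x)} f(x′, κ)`), ★ `isAdj_pull_ravg` (`P = pull kingPrV ↔ R` for the weights `η′^{d+1}`, `η^{d+1}`: `η′^{d+1}·L^{m(d+1)} = η^{d+1}`).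
HONEST FRAMING ∕ LIMITS.  Finite-dimensional linear algebra ([folklore]; the one cited sentence is Prop. 1.1's symmetry of `G`); NO estimate; the operator `S = T2†` and its bounds are the
sequels; count-neutral (typed 28∕28 · discharged 5∕27 of record unchanged); NOT a discharge of N15 (object-bound; NE2⁺ NOT PRINTED); one finite T⁴ at fixed ε — NOT infinite volume, NOT OS on
ℝ⁴, NOT a mass gap, NOT Clay.
-/

noncomputable section

open scoped BigOperators Matrix
open Finset

namespace Summit.QuantumFields.YangMills.BalabanUVNodes.N15.TwoGrid

open Literature.MathematicalPhysics.QuantumFieldTheory.Balaban1983to89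
open Literature.MathematicalPhysics.QuantumFieldTheory.Balaban1983to89.T4EtaRateCoeffDefect (pull pull_apply fibre mem_fibre)
open Literature.MathematicalPhysics.QuantumFieldTheory.Balaban1983to89.B5Prop11Plancherel (Tor fine unitVec)
open Literature.MathematicalPhysics.QuantumFieldTheory.Balaban1983to89.B5RealFields (GR DeltaAR reM GR_transpose DeltaAR_transpose reM_transpose_of_isHermitian)
open Literature.MathematicalPhysics.QuantumFieldTheory.Balaban1983to89.B5Value126 (PcT PcT_conjTranspose)
open Literature.MathematicalPhysics.QuantumFieldTheory.Balaban1983to89.B5SettingP12Weighted (etaPow etaPow_nonneg)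
open Summit.QuantumFields.YangMills.BalabanUVNodes.N15.VectorPiece (kingPr kingPrV kingPrV_eq kingPr_val)

variable {d : ℕ}

/-! ## §85 The weighted pairing and the adjoint calculus -/

section IsAdj

variable {X₁ X₂ X₃ : Type} [Fintype X₁] [Fintype X₂] [Fintype X₃]

/-- **THE η-WEIGHTED PAIRING** `⟨u, v⟩_w = w·Σ_x u(x)v(x)` on real lattice fields, as a bilinear form (for `w = η^{d+1}`: the Riemann sum of `∫uv` on `T_η`).  Adjointness below is Mathlib's
`LinearMap.IsAdjointPair (wdot w₁) (wdot w₂) T S`, i.e. `⟨Tμ, f⟩_{w₂} = ⟨μ, Sf⟩_{w₁}` for all `μ`, `f`. [cite: Balaban1984PropagatorsI, Prop. 1.1 p.33 (L²(T_η) pairing)] -/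
def wdot (w : ℝ) : (X₁ → ℝ) →ₗ[ℝ] (X₁ → ℝ) →ₗ[ℝ] ℝ :=
  LinearMap.mk₂ ℝ (fun u v : X₁ → ℝ => w * ∑ x, u x * v x)
    (fun u u' v => by simp only [Pi.add_apply, add_mul, sum_add_distrib, mul_add])
    (fun c u v => by
      simp only [Pi.smul_apply, smul_eq_mul]
      rw [show ∑ x, c * u x * v x = c * ∑ x, u x * v x by rw [mul_sum]; exact sum_congr rfl fun _ _ => by ring]; ring)
    (fun u v v' => by simp only [Pi.add_apply, mul_add, sum_add_distrib])
    (fun c u v => by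
      simp only [Pi.smul_apply, smul_eq_mul]
      rw [show ∑ x, u x * (c * v x) = c * ∑ x, u x * v x by rw [mul_sum]; exact sum_congr rfl fun _ _ => by ring]; ring)

/-- pointwise form of the pairing. [folklore] -/
@[simp] theorem wdot_apply (w : ℝ) (u v : X₁ → ℝ) : wdot w u v = w * ∑ x, u x * v x := rfl

variable {w₁ w₂ w₃ : ℝ}

/-- **THE SUM FORM OF ADJOINTNESS**: `S` is the `(w₁, w₂)`-adjoint of `T` iff `w₂·Σ_{x₂} f(x₂)(Tμ)(x₂) = w₁·Σ_{x₁} (Sf)(x₁)μ(x₁)` for all `μ`, `f` — the hypothesis shape of part 61's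
`hasMaj_of_adjoint`. [folklore] -/
theorem isAdj_iff {T : (X₁ → ℝ) →ₗ[ℝ] (X₂ → ℝ)} {S : (X₂ → ℝ) →ₗ[ℝ] (X₁ → ℝ)} :
    LinearMap.IsAdjointPair (wdot w₁) (wdot w₂) T S ↔ ∀ (μ : X₁ → ℝ) (f : X₂ → ℝ), w₂ * ∑ x₂, f x₂ * T μ x₂ = w₁ * ∑ x₁, S f x₁ * μ x₁ := by
  refine forall₂_congr fun μ f => ?_
  rw [wdot_apply, wdot_apply, show ∑ x₂, T μ x₂ * f x₂ = ∑ x₂, f x₂ * T μ x₂ from sum_congr rfl fun _ _ => mul_comm _ _,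
    show ∑ x₁, μ x₁ * S f x₁ = ∑ x₁, S f x₁ * μ x₁ from sum_congr rfl fun _ _ => mul_comm _ _]

/-- symmetry: `T` is the adjoint of its adjoint. [folklore] -/
theorem isAdjW_symm {T : (X₁ → ℝ) →ₗ[ℝ] (X₂ → ℝ)} {S : (X₂ → ℝ) →ₗ[ℝ] (X₁ → ℝ)} (h : LinearMap.IsAdjointPair (wdot w₁) (wdot w₂) T S) :
    LinearMap.IsAdjointPair (wdot w₂) (wdot w₁) S T := isAdj_iff.2 fun f μ => by
  rw [show ∑ x₁, μ x₁ * S f x₁ = ∑ x₁, S f x₁ * μ x₁ from sum_congr rfl fun _ _ => mul_comm _ _,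
    show ∑ x₂, T μ x₂ * f x₂ = ∑ x₂, f x₂ * T μ x₂ from sum_congr rfl fun _ _ => mul_comm _ _]
  exact (isAdj_iff.1 h μ f).symm

/-- composition: `(T′∘T)† = T†∘T′†`. [folklore] -/
theorem isAdjW_comp {T : (X₁ → ℝ) →ₗ[ℝ] (X₂ → ℝ)} {S : (X₂ → ℝ) →ₗ[ℝ] (X₁ → ℝ)} {T' : (X₂ → ℝ) →ₗ[ℝ] (X₃ → ℝ)} {S' : (X₃ → ℝ) →ₗ[ℝ] (X₂ → ℝ)}
    (h' : LinearMap.IsAdjointPair (wdot w₂) (wdot w₃) T' S') (h : LinearMap.IsAdjointPair (wdot w₁) (wdot w₂) T S) :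
    LinearMap.IsAdjointPair (wdot w₁) (wdot w₃) (T' ∘ₗ T) (S ∘ₗ S') := isAdj_iff.2 fun μ g => by
  rw [LinearMap.comp_apply, isAdj_iff.1 h' (T μ) g, LinearMap.comp_apply, isAdj_iff.1 h μ (S' g)]

/-- sums. [folklore] -/
theorem isAdjW_add {T T' : (X₁ → ℝ) →ₗ[ℝ] (X₂ → ℝ)} {S S' : (X₂ → ℝ) →ₗ[ℝ] (X₁ → ℝ)} (h : LinearMap.IsAdjointPair (wdot w₁) (wdot w₂) T S)
    (h' : LinearMap.IsAdjointPair (wdot w₁) (wdot w₂) T' S') : LinearMap.IsAdjointPair (wdot w₁) (wdot w₂) ⇑(T + T') ⇑(S + S') := isAdj_iff.2 fun μ f => by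
  simp only [LinearMap.add_apply, Pi.add_apply, mul_add, add_mul, sum_add_distrib]
  rw [isAdj_iff.1 h μ f, isAdj_iff.1 h' μ f]

/-- negation. [folklore] -/
theorem isAdjW_neg {T : (X₁ → ℝ) →ₗ[ℝ] (X₂ → ℝ)} {S : (X₂ → ℝ) →ₗ[ℝ] (X₁ → ℝ)} (h : LinearMap.IsAdjointPair (wdot w₁) (wdot w₂) T S) :
    LinearMap.IsAdjointPair (wdot w₁) (wdot w₂) ⇑(-T) ⇑(-S) := isAdj_iff.2 fun μ f => by
  simp only [LinearMap.neg_apply, Pi.neg_apply, mul_neg, neg_mul, sum_neg_distrib]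
  rw [isAdj_iff.1 h μ f]

/-- differences. [folklore] -/
theorem isAdjW_sub {T T' : (X₁ → ℝ) →ₗ[ℝ] (X₂ → ℝ)} {S S' : (X₂ → ℝ) →ₗ[ℝ] (X₁ → ℝ)} (h : LinearMap.IsAdjointPair (wdot w₁) (wdot w₂) T S)
    (h' : LinearMap.IsAdjointPair (wdot w₁) (wdot w₂) T' S') : LinearMap.IsAdjointPair (wdot w₁) (wdot w₂) ⇑(T - T') ⇑(S - S') := by
  rw [sub_eq_add_neg, sub_eq_add_neg]; exact isAdjW_add h (isAdjW_neg h')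

/-- scalars. [folklore] -/
theorem isAdjW_smul {T : (X₁ → ℝ) →ₗ[ℝ] (X₂ → ℝ)} {S : (X₂ → ℝ) →ₗ[ℝ] (X₁ → ℝ)} (h : LinearMap.IsAdjointPair (wdot w₁) (wdot w₂) T S) (c : ℝ) :
    LinearMap.IsAdjointPair (wdot w₁) (wdot w₂) ⇑(c • T) ⇑(c • S) := isAdj_iff.2 fun μ f => by
  simp only [LinearMap.smul_apply, Pi.smul_apply, smul_eq_mul]
  have e1 : ∑ x₂, f x₂ * (c * T μ x₂) = c * ∑ x₂, f x₂ * T μ x₂ := by rw [mul_sum]; exact sum_congr rfl fun _ _ => by ring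
  have e2 : ∑ x₁, c * S f x₁ * μ x₁ = c * ∑ x₁, S f x₁ * μ x₁ := by rw [mul_sum]; exact sum_congr rfl fun _ _ => by ring
  rw [e1, e2, mul_left_comm, isAdj_iff.1 h μ f, mul_left_comm]

/-- the zero operator. [folklore] -/
theorem isAdjW_zero : LinearMap.IsAdjointPair (wdot w₁) (wdot w₂) ⇑(0 : (X₁ → ℝ) →ₗ[ℝ] (X₂ → ℝ)) ⇑(0 : (X₂ → ℝ) →ₗ[ℝ] (X₁ → ℝ)) :=
  isAdj_iff.2 fun μ f => by simp

/-- the identity (one weight). [folklore] -/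
theorem isAdjW_id : LinearMap.IsAdjointPair (wdot w₁) (wdot w₁) ⇑(LinearMap.id : (X₁ → ℝ) →ₗ[ℝ] (X₁ → ℝ)) ⇑(LinearMap.id : (X₁ → ℝ) →ₗ[ℝ] (X₁ → ℝ)) :=
  isAdj_iff.2 fun μ f => by simp only [LinearMap.id_apply]

/-- finite sums. [folklore] -/
theorem isAdjW_sum {ι : Type} (s : Finset ι) {T : ι → (X₁ → ℝ) →ₗ[ℝ] (X₂ → ℝ)} {S : ι → (X₂ → ℝ) →ₗ[ℝ] (X₁ → ℝ)}
    (h : ∀ i ∈ s, LinearMap.IsAdjointPair (wdot w₁) (wdot w₂) (T i) (S i)) :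
    LinearMap.IsAdjointPair (wdot w₁) (wdot w₂) ⇑(∑ i ∈ s, T i) ⇑(∑ i ∈ s, S i) := by
  classical
  induction s using Finset.induction_on with
  | empty => rw [sum_empty, sum_empty]; exact isAdjW_zero
  | insert i s hi ih =>
      rw [sum_insert hi, sum_insert hi]
      exact isAdjW_add (h i (mem_insert_self i s)) (ih fun j hj => h j (mem_insert_of_mem hj))

/-- **UNIQUENESS** (`w₁ ≠ 0`): two adjoints of the same operator agree — the tool that transports OPERATOR IDENTITIES across the pairing. [folklore] -/
theorem isAdjW_unique (hw₁ : w₁ ≠ 0) {T : (X₁ → ℝ) →ₗ[ℝ] (X₂ → ℝ)} {S S' : (X₂ → ℝ) →ₗ[ℝ] (X₁ → ℝ)} (h : LinearMap.IsAdjointPair (wdot w₁) (wdot w₂) T S)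
    (h' : LinearMap.IsAdjointPair (wdot w₁) (wdot w₂) T S') : S = S' := by
  classical
  refine LinearMap.ext fun f => funext fun x => ?_
  have key := (isAdj_iff.1 h (Pi.single x 1) f).symm.trans (isAdj_iff.1 h' (Pi.single x 1) f)
  have e : ∀ S₀ : (X₂ → ℝ) →ₗ[ℝ] (X₁ → ℝ), ∑ x₁, S₀ f x₁ * (Pi.single x (1 : ℝ) : X₁ → ℝ) x₁ = S₀ f x := fun S₀ => by
    rw [sum_eq_single x (fun x₁ _ hx₁ => by rw [Pi.single_eq_of_ne hx₁, mul_zero]) (fun hx => absurd (mem_univ x) hx), Pi.single_eq_same, mul_one]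
  rw [e, e] at key
  exact mul_left_cancel₀ hw₁ key

/-- transport of adjointness along operator equalities. [folklore] -/
theorem isAdjW_congr {T T' : (X₁ → ℝ) →ₗ[ℝ] (X₂ → ℝ)} {S S' : (X₂ → ℝ) →ₗ[ℝ] (X₁ → ℝ)} (h : LinearMap.IsAdjointPair (wdot w₁) (wdot w₂) T S) (hT : T = T')
    (hS : S = S') : LinearMap.IsAdjointPair (wdot w₁) (wdot w₂) T' S' := by
  subst hT hS; exact h

end IsAdj

/-! ## §86 Same-lattice adjoint pairs -/

section Same

variable {X : Type} [Fintype X] {w : ℝ}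

/-- a matrix against its transpose: `Σ f·(Aμ) = Σ (Aᵀf)·μ`. [folklore] -/
theorem isAdj_mulVecLin (A : Matrix X X ℝ) : LinearMap.IsAdjointPair (wdot w) (wdot w) (Matrix.mulVecLin A) (Matrix.mulVecLin Aᵀ) := isAdj_iff.2 fun μ f => by
  congr 1
  simp only [Matrix.mulVecLin_apply]
  have h1 : ∑ x, f x * (A *ᵥ μ) x = f ⬝ᵥ (A *ᵥ μ) := rfl
  have h2 : ∑ x, (Aᵀ *ᵥ f) x * μ x = (Aᵀ *ᵥ f) ⬝ᵥ μ := rfl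
  rw [h1, h2, Matrix.dotProduct_mulVec, Matrix.mulVec_transpose]

variable (M : Fin (d + 1) → ℕ) [∀ μ, NeZero (M μ)] (n : ℕ) [NeZero n] (a : ℝ)

/-- ★ **`G = Δ_a⁻¹` IS SYMMETRIC** (*"The operator G is a symmetric operator on L²(T_η)"*): `gOp` is its own adjoint (`GR_transpose`). [cite: Balaban1984PropagatorsI, Prop. 1.1 p.33] -/
theorem isAdj_gOp (hn : 1 ≤ n) (ha : 0 < a) : LinearMap.IsAdjointPair (wdot w) (wdot w) (gOp M n a) (gOp M n a) := by
  have h := isAdj_mulVecLin (w := w) (GR n M a)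
  rw [GR_transpose n hn M a ha] at h
  exact h

/-- `Δ_a` is symmetric (`DeltaAR_transpose`). [cite: Balaban1984PropagatorsI, (1.69) p.29] -/
theorem isAdj_deltaOp (hn : 1 ≤ n) (ha : 0 < a) : LinearMap.IsAdjointPair (wdot w) (wdot w) (deltaOp M n a) (deltaOp M n a) := by
  have h := isAdj_mulVecLin (w := w) (DeltaAR n M a)
  rw [DeltaAR_transpose n hn M a ha] at h
  exact h

/-- ★ **`∂Π∂*` IS SYMMETRIC**: the Landau term `landauRe` is its own adjoint (`PcTᴴ = PcT` ⇒ `(∂Π∂*)ᴴ = ∂Π∂*` ⇒ its real part is a symmetric matrix). [cite: Balaban1984PropagatorsI, (1.69)–(1.70) p.29] -/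
theorem isAdj_landauRe : LinearMap.IsAdjointPair (wdot w) (wdot w) (landauRe M n) (landauRe M n) := by
  have hH : (B5Action121.GradOp (fine n M) (n : ℂ) * PcT n M (n : ℂ) * (B5Action121.GradOp (fine n M) (n : ℂ))ᴴ).IsHermitian := by
    have h := Matrix.isHermitian_mul_mul_conjTranspose (B5Action121.GradOp (fine n M) (n : ℂ)) (show (PcT n M (n : ℂ)).IsHermitian from PcT_conjTranspose n M (n : ℂ))
    exact h
  have h := isAdj_mulVecLin (w := w) (reM (B5Action121.GradOp (fine n M) (n : ℂ) * PcT n M (n : ℂ) * (B5Action121.GradOp (fine n M) (n : ℂ))ᴴ))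
  rw [reM_transpose_of_isHermitian hH] at h
  exact h

/-- a translation against the inverse translation: `Σ_x f(x)·c·u(x+v) = Σ_x c·f(x−v)·u(x)`. [folklore] -/
theorem isAdj_symbOp_single (v : Tor (fine n M)) (c : ℝ) :
    LinearMap.IsAdjointPair (wdot w) (wdot w) (symbOp M n (AddMonoidAlgebra.single v c)) (symbOp M n (AddMonoidAlgebra.single (-v) c)) := isAdj_iff.2 fun μ f => by
  congr 1
  simp only [symbOp_single_apply]
  refine Fintype.sum_equiv (Equiv.prodCongr (Equiv.addRight v) (Equiv.refl (Fin (d + 1)))) _ _ fun i => ?_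
  show f i * (c * μ (i.1 + v, i.2)) = c * f (i.1 + v + -v, i.2) * μ (i.1 + v, i.2)
  rw [add_neg_cancel_right]
  ring

/-- closure under products of symbols (the symbol algebra is commutative): `ρ(στ)† = ρ(σ̄τ̄)`. [folklore] -/
theorem isAdj_symbOp_mul {σ σ' τ τ' : AddMonoidAlgebra ℝ (Tor (fine n M))} (hσ : LinearMap.IsAdjointPair (wdot w) (wdot w) (symbOp M n σ) (symbOp M n σ')) (hτ : LinearMap.IsAdjointPair (wdot w) (wdot w) (symbOp M n τ) (symbOp M n τ')) :
    LinearMap.IsAdjointPair (wdot w) (wdot w) (symbOp M n (σ * τ)) (symbOp M n (σ' * τ')) := by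
  rw [mul_comm σ' τ', map_mul, map_mul, Module.End.mul_eq_comp, Module.End.mul_eq_comp]
  exact isAdjW_comp hσ hτ

/-- closure under sums of symbols. [folklore] -/
theorem isAdj_symbOp_add {σ σ' τ τ' : AddMonoidAlgebra ℝ (Tor (fine n M))} (hσ : LinearMap.IsAdjointPair (wdot w) (wdot w) (symbOp M n σ) (symbOp M n σ')) (hτ : LinearMap.IsAdjointPair (wdot w) (wdot w) (symbOp M n τ) (symbOp M n τ')) :
    LinearMap.IsAdjointPair (wdot w) (wdot w) (symbOp M n (σ + τ)) (symbOp M n (σ' + τ')) := by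
  rw [map_add, map_add]; exact isAdjW_add hσ hτ

/-- closure under differences of symbols. [folklore] -/
theorem isAdj_symbOp_sub {σ σ' τ τ' : AddMonoidAlgebra ℝ (Tor (fine n M))} (hσ : LinearMap.IsAdjointPair (wdot w) (wdot w) (symbOp M n σ) (symbOp M n σ')) (hτ : LinearMap.IsAdjointPair (wdot w) (wdot w) (symbOp M n τ) (symbOp M n τ')) :
    LinearMap.IsAdjointPair (wdot w) (wdot w) (symbOp M n (σ - τ)) (symbOp M n (σ' - τ')) := by
  rw [map_sub, map_sub]; exact isAdjW_sub hσ hτ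

/-- closure under scalars. [folklore] -/
theorem isAdj_symbOp_smul {σ σ' : AddMonoidAlgebra ℝ (Tor (fine n M))} (hσ : LinearMap.IsAdjointPair (wdot w) (wdot w) (symbOp M n σ) (symbOp M n σ')) (c : ℝ) :
    LinearMap.IsAdjointPair (wdot w) (wdot w) (symbOp M n (c • σ)) (symbOp M n (c • σ')) := by
  rw [map_smul, map_smul]; exact isAdjW_smul hσ c

/-- `ρ(1)† = ρ(1)`. [folklore] -/
theorem isAdj_symbOp_one : LinearMap.IsAdjointPair (wdot w) (wdot w) (symbOp M n 1) (symbOp M n 1) := by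
  rw [map_one, Module.End.one_eq_id]; exact isAdjW_id

/-- the shift against the backward shift: `ρ(s_κ)† = ρ(s_κ⁻¹)`. [folklore] -/
theorem isAdj_sT (κ : Fin (d + 1)) : LinearMap.IsAdjointPair (wdot w) (wdot w) (symbOp M n (sT M n κ)) (symbOp M n (sTinv M n κ)) :=
  isAdj_symbOp_single M n (unitVec (fine n M) κ) 1

/-- … and conversely. [folklore] -/
theorem isAdj_sTinv (κ : Fin (d + 1)) : LinearMap.IsAdjointPair (wdot w) (wdot w) (symbOp M n (sTinv M n κ)) (symbOp M n (sT M n κ)) := by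
  have h := isAdj_symbOp_single (w := w) M n (-unitVec (fine n M) κ) 1
  rw [neg_neg] at h
  exact h

/-- powers of the shift. [folklore] -/
theorem isAdj_sT_pow (κ : Fin (d + 1)) (j : ℕ) : LinearMap.IsAdjointPair (wdot w) (wdot w) (symbOp M n (sT M n κ ^ j)) (symbOp M n (sTinv M n κ ^ j)) := by
  induction j with
  | zero => rw [pow_zero, pow_zero]; exact isAdj_symbOp_one M n
  | succ j ih => rw [pow_succ, pow_succ]; exact isAdj_symbOp_mul M n ih (isAdj_sT M n κ)

/-- powers of the backward shift. [folklore] -/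
theorem isAdj_sTinv_pow (κ : Fin (d + 1)) (j : ℕ) : LinearMap.IsAdjointPair (wdot w) (wdot w) (symbOp M n (sTinv M n κ ^ j)) (symbOp M n (sT M n κ ^ j)) := by
  induction j with
  | zero => rw [pow_zero, pow_zero]; exact isAdj_symbOp_one M n
  | succ j ih => rw [pow_succ, pow_succ]; exact isAdj_symbOp_mul M n ih (isAdj_sTinv M n κ)

/-- ★ **`∇_ν† = ∇_ν*`**: the forward difference quotient `ρ(c(s_ν − 1))` against the backward one `ρ(c(s_ν⁻¹ − 1))`. [cite: Balaban1984PropagatorsI, (1.31) p.23 (∇ and its adjoint ∇*)] -/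
theorem isAdj_sD (κ : Fin (d + 1)) (c : ℝ) : LinearMap.IsAdjointPair (wdot w) (wdot w) (symbOp M n (sD M n κ c)) (symbOp M n (c • (sTinv M n κ - 1))) := by
  rw [sD]; exact isAdj_symbOp_smul M n (isAdj_symbOp_sub M n (isAdj_sT M n κ) (isAdj_symbOp_one M n)) c

/-- … and `(∇_ν*)† = ∇_ν`. [cite: Balaban1984PropagatorsI, (1.31) p.23] -/
theorem isAdj_sDbar (κ : Fin (d + 1)) (c : ℝ) : LinearMap.IsAdjointPair (wdot w) (wdot w) (symbOp M n (c • (sTinv M n κ - 1))) (symbOp M n (sD M n κ c)) :=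
  isAdjW_symm (isAdj_sD M n κ c)

omit [∀ μ, NeZero (M μ)] [NeZero n] in
/-- the directional Laplacian symbol is self-adjoint: `sLapDir = (c(s⁻¹−1))·(c(s−1))` up to the relation `s·s⁻¹ = 1`. [cite: Balaban1984PropagatorsI, (1.21) p.21] -/
theorem sLapDir_eq_sDbar_mul_sD (ν : Fin (d + 1)) (c : ℝ) : sLapDir M n ν c = (c • (sTinv M n ν - 1)) * sD M n ν c := by
  have h := sT_mul_sTinv M n ν
  rw [sLapDir, sD, Algebra.smul_def, Algebra.smul_def]
  linear_combination (-(algebraMap ℝ (AddMonoidAlgebra ℝ (Tor (fine n M))) c) ^ 2 * (sT M n ν - 1)) * h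

/-- `ρ(sLapDir)† = ρ(sLapDir)`. [cite: Balaban1984PropagatorsI, (1.21) p.21] -/
theorem isAdj_sLapDir (ν : Fin (d + 1)) (c : ℝ) : LinearMap.IsAdjointPair (wdot w) (wdot w) (symbOp M n (sLapDir M n ν c)) (symbOp M n (sLapDir M n ν c)) := by
  have h := isAdj_symbOp_mul M n (isAdj_sDbar (w := w) M n ν c) (isAdj_sD M n ν c)
  rw [← sLapDir_eq_sDbar_mul_sD, mul_comm, ← sLapDir_eq_sDbar_mul_sD] at h
  exact h

/-- `ρ(sLap)† = ρ(sLap)`. [cite: Balaban1984PropagatorsI, (1.21) p.21] -/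
theorem isAdj_sLap (c : ℝ) : LinearMap.IsAdjointPair (wdot w) (wdot w) (symbOp M n (sLap M n c)) (symbOp M n (sLap M n c)) := by
  rw [sLap, map_sum]
  exact isAdjW_sum univ fun ν _ => isAdj_sLapDir M n ν c

/-- ★ **`a·Q*Q` IS SELF-ADJOINT** on real 1-forms: `a·Q*Q = Δ_a − ρ(sLap) + ∂Π∂*` (part 46 `deltaOp_eq`), each term symmetric. [cite: Balaban1984PropagatorsI, (1.69) p.29 (Δ_a = Δ − ∂P∂* + aQ*Q)] -/
theorem isAdj_qq (hn : 1 ≤ n) (ha : 0 < a) : LinearMap.IsAdjointPair (wdot w) (wdot w) ⇑(a • (qvAdjRe M n ∘ₗ qvRe M n)) ⇑(a • (qvAdjRe M n ∘ₗ qvRe M n)) := by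
  have e : a • (qvAdjRe M n ∘ₗ qvRe M n) = deltaOp M n a - symbOp M n (sLap M n n) + landauRe M n := by
    rw [deltaOp_eq]; abel
  rw [e]
  exact isAdjW_add (isAdjW_sub (isAdj_deltaOp M n a hn ha) (isAdj_sLap M n (n : ℝ))) (isAdj_landauRe M n)

end Same

/-! ## §87 The two-lattice pair: King's prolongation `P` against the block average `R` -/

section TwoLattice

variable (M : Fin (d + 1) → ℕ) [∀ μ, NeZero (M μ)] (L k m : ℕ) [NeZero L]

/-- **KING's BLOCK AVERAGE `R`** of fine 1-forms over the `L^m`-blocks of King's pairing: `(Rf)(x, κ) = L^{−m(d+1)}·Σ_{x′ : pr x′ = x} f(x′, κ)` — the `η^{d+1}`∕`η′^{d+1}`-weighted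
adjoint of the piecewise-constant prolongation `P = pull kingPrV` (`isAdj_pull_ravg`). [cite: King1986, p.664 (pairing convention «x′ ∈ B^n(x)»; Q_k as block average, (2.5) p.661)] -/
def ravg : (Tor (fine (L ^ m * L ^ k) M) × Fin (d + 1) → ℝ) →ₗ[ℝ] (Tor (fine (L ^ k) M) × Fin (d + 1) → ℝ) where
  toFun f := fun i => (((L : ℝ) ^ m) ^ (d + 1))⁻¹ * ∑ x' ∈ fibre (kingPr L k m M) i.1, f (x', i.2)
  map_add' f g := by funext i; simp only [Pi.add_apply, sum_add_distrib, mul_add]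
  map_smul' c f := by funext i; simp only [Pi.smul_apply, smul_eq_mul, RingHom.id_apply, ← mul_sum]; ring

/-- pointwise form. [folklore] -/
theorem ravg_apply (f : Tor (fine (L ^ m * L ^ k) M) × Fin (d + 1) → ℝ) (i : Tor (fine (L ^ k) M) × Fin (d + 1)) :
    ravg M L k m f i = (((L : ℝ) ^ m) ^ (d + 1))⁻¹ * ∑ x' ∈ fibre (kingPr L k m M) i.1, f (x', i.2) := rfl

/-- the fibre sum as a sum over all fine bonds with an indicator (for exchanging sums). [folklore] -/
theorem sum_fibre_eq_sum_ite (g : Tor (fine (L ^ m * L ^ k) M) → ℝ) (x : Tor (fine (L ^ k) M)) :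
    ∑ x' ∈ fibre (kingPr L k m M) x, g x' = ∑ x' : Tor (fine (L ^ m * L ^ k) M), if kingPr L k m M x' = x then g x' else 0 := by
  classical
  rw [fibre, sum_filter]

/-- ★ **`P† = R`**: `η′^{d+1}·Σ_{x′} f(x′)(Pu)(x′) = η^{d+1}·Σ_x (Rf)(x)u(x)` with `η = (L^k)⁻¹`, `η′ = (L^mL^k)⁻¹` (`η′^{d+1}·L^{m(d+1)} = η^{d+1}`). [cite: King1986, p.664 (pairing convention)] -/
theorem isAdj_pull_ravg :
    LinearMap.IsAdjointPair (wdot (etaPow (L ^ k) (d + 1))) (wdot (etaPow (L ^ m * L ^ k) (d + 1))) (pull (kingPrV L k m M)) (ravg M L k m) := by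
  classical
  refine isAdj_iff.2 fun u f => ?_
  -- weights: `η′^{D} = η^{D} · (L^m)^{−D}`
  have hw : etaPow (L ^ m * L ^ k) (d + 1) = etaPow (L ^ k) (d + 1) * (((L : ℝ) ^ m) ^ (d + 1))⁻¹ := by
    unfold etaPow
    rw [← inv_pow, ← mul_pow, ← mul_inv]
    congr 2
    push_cast; ring
  rw [hw, mul_assoc]
  congr 1
  -- `(L^m)^{−D} Σ_{x′} f(x′) u(pr x′) = Σ_x (Rf)(x) u(x)`, bond direction passive
  have key : ∀ κ : Fin (d + 1), ∑ x' : Tor (fine (L ^ m * L ^ k) M), f (x', κ) * u (kingPr L k m M x', κ)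
      = ∑ x : Tor (fine (L ^ k) M), (∑ x' ∈ fibre (kingPr L k m M) x, f (x', κ)) * u (x, κ) := by
    intro κ
    rw [← Finset.sum_fiberwise univ (kingPr L k m M) (fun x' => f (x', κ) * u (kingPr L k m M x', κ))]
    refine sum_congr rfl fun x _ => ?_
    rw [fibre, sum_mul]
    exact sum_congr rfl fun x' hx' => by rw [(mem_filter.mp hx').2]
  have eL : ∑ x₂, f x₂ * pull (kingPrV L k m M) u x₂ = ∑ κ : Fin (d + 1), ∑ x' : Tor (fine (L ^ m * L ^ k) M), f (x', κ) * u (kingPr L k m M x', κ) := by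
    rw [Fintype.sum_prod_type, Finset.sum_comm]; rfl
  have eR : ∑ x₁, ravg M L k m f x₁ * u x₁
      = ∑ κ : Fin (d + 1), ∑ x : Tor (fine (L ^ k) M), ((((L : ℝ) ^ m) ^ (d + 1))⁻¹ * ∑ x' ∈ fibre (kingPr L k m M) x, f (x', κ)) * u (x, κ) := by
    rw [Fintype.sum_prod_type, Finset.sum_comm]; rfl
  rw [eL, eR, mul_sum]
  refine sum_congr rfl fun κ _ => ?_
  rw [key κ, mul_sum]
  exact sum_congr rfl fun x _ => by ring

end TwoLattice

end Summit.QuantumFields.YangMills.BalabanUVNodes.N15.TwoGrid
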